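import Summits.ABC.IUTFork.ForkEta
import Mathlib.Order.Closure
import HarnessLib

/-!
# The fork at [IUTchIII] Corollary 3.12, XVII: the Corollary's own nouns — regions, possible images, hull

Record-only file (D-0012) of the abc-iut cell's fork skeleton; TAKES NO SIDE. Files I–XVI type the fork at
the level of REAL NUMBERS (degrees, log-volumes, copies of `ℝ`, pointed lines). Corollary 3.12 itself is
stated one level below, about REGIONS in a container: "Write `−|log(Θ)|` … for the procession-normalized
mono-analytic log-volume … of the holomorphic hull … of the union of the possible images of a Θ-pilot
object …, which we regard as subject to the indeterminacies (Ind1), (Ind2), (Ind3) … Write `−|log(q)|` … for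
the procession-normalized mono-analytic log-volume of the image of a `q`-pilot object …, which we do *not*
regard as subject to the indeterminacies … Then it holds that `−|log(Θ)| ∈ ℝ`, and `−|log(Θ)| ≥ −|log(q)|`"
([IUTchIII] Cor. 3.12, kurims 2020 text pp. 173–174, transcribed in the cell's `plan/COR312-TEXT.md`).
Dupuy–Hilado print the same with explicit regions: "`U_Θ = Ind2·(Ind1·(O_𝕃(−P_Θ))^{Ind3}) ⊂ 𝕃` … The order
of operations … is intentional and correct", "`𝕃` is equipped with a collection of subsets `N(𝕃)` and a map
`ln ν̄ : N(𝕃) → ℝ` such that `ln ν̄_𝕃(hull(U_Θ)) = −deĝ_lgp(P_{hull(U_Θ)})`", the inequality being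
"`−deĝ(P_q) ≤ −deĝ_lgp(P_{hull(U_Θ)})`" (§1 pp. 3–4); LANA describe the same as a procedure on the big-H
diagram (§8.1 (a)–(i) pp. 40–41) ending "Mochizuki asserts that, by properties of the algorithm itself such as
(IPL), (SHE), and (APT) … the procedure … becomes a way of calculating, with indeterminacies, the real number
`−|log(q)|` … He further asserts that, on the basis of this, one can construct a proof that obtains …
`−|log(q)| ≤ −|log(Θ)|` (8-1)" and (§8.3 p. 43) "Then, accordiong [sic] to Mochizuki's interpretation ([12, Step
(xi) of the proof of Cor. 3.12]), the IPL, SHE, and APT properties implies that the set of procession-normalized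
log-volumes of the admissible output regions contains the `q`-pilot log-volume as one of its possible values"
(the attribution frames are LANA's).

This file types exactly these nouns, schematically (a container with admissible regions, a monotone
log-volume, a hull operator; possible images `U_λ`; the `q`-pilot image `Q`), and proves what follows
formally — nothing about who is right:

* `Cor312Setting.logvol_U_le_negLogTheta`: every possible image has log-volume `≤ −|log(Θ)|`, by
  monotonicity of `ln ν̄` and extensivity of the hull. Hence the HYPOTHESIS fields `vol_le_hull` of
  `ForkLana.OutputRegions` and `vol_LGP_le_hull` of `ForkEta.EtaSetting` are DISCHARGED in every set-level
  model (`toOutputRegions`, `toEtaSetting`), and LANA's (9-1) for the carried `η`-setting is Reading 1 below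
  (`mainGoal_iff_representedVol`).
* The three readings of the disputed Step (xi) that the texts suggest at this level — `RepresentedVol`
  (LANA §8.3/§9.3: the `q`-pilot log-volume is one of the possible values), `QSubHull` (the `q`-pilot image
  lies in the hull), `QIsImage` (the `q`-pilot image IS a possible image) — with the PROVED implications
  `QIsImage → RepresentedVol`, `QIsImage → QSubHull`, `RepresentedVol → Cor312`, `QSubHull → Cor312`
  (each one line: the content is the antecedent; none is asserted), and `readings_differ` (a finite
  container in which `Cor312` holds while `RepresentedVol` and `QSubHull` both fail).
* The CALIBRATION of these nouns by the pilot divisors (what the inequality costs: the inflation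
  `deĝ_lgp(P_Θ) − deĝ(P_q)` that the indeterminacies and the hull must supply), the squeeze with the multiradial
  estimate, and Dupuy–Hilado's order of operations `Ind2(Ind1((O_𝕃(−P_Θ))^{Ind3}))` are in the sibling
  `ForkInflation.lean` (XVIII).

Sources read on the page: [IUTchIII] Cor. 3.12 (cell transcription); Dupuy–Hilado arXiv:2004.13228 §1
pp. 3–4, §3.9–§3.10 pp. 11–12 (render `paper:arxiv-2004.13228`); LANA report pp. 40–43
(`paper:url-7e4c7f9f3efc`). [cite: DupuyHilado2025, §1 pp. 3–4, Thm. 3.10.1 p. 12]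
[cite: LANA2026Report, §8.1 pp. 40–41, §8.3 p. 43] [claim: Mochizuki2012, status: disputed]
Deliberately NOT here: the construction of the possible images (the `η`-algorithm, [IUTchIII] Thm 3.11;
LANA §9.1), Ind1/Ind2 as explicit automorphism groups of tensor packets and Ind3 (L-DH D3/D4/D6/D7 —
Dupuy–Hilado p. 4: "the meaning of the symbol `(O_𝕃(−P_Θ))^{Ind3}` is a bit nuanced and is not just the
application of the function `Ind3` on a set `O_𝕃(−P_Θ)`"), (IPL)/(SHE)/(APT) (not typable as printed, LANA Rem. 8.2.1);
any judgement.
-/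

noncomputable section

open Set

namespace Summit.ABC

namespace IUTFork

/-! ## 1. Volume containers and the nouns of Corollary 3.12 -/

/-- A (LARGE) VOLUME CONTAINER, schematically: a carrier `𝕃` (Dupuy–Hilado §1 p. 3: "an "adelic" abelian
group `𝕃` which is abstractly isomorphic to a space that appears in [IUT3]. In Mochizuki's notation
`𝕃 ≅ I^ℚ(^{S±}F(^{n,∘}D_≻))_{V_ℚ}`"; LANA §5.2 pp. 28–29 "volume container" `VC(I)`, footnote 8 p. 42: "we
can think of a "tensor packet" as what we call a "large volume container""), a class of ADMISSIBLE regions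
with a LOG-VOLUME (DH p. 4: "`𝕃` is equipped with a collection of subsets `N(𝕃)` and a map
`ln ν̄ : N(𝕃) → ℝ`" — "not actually logarithms of volumes but rather averages of weighted sums of logs of
normalized `p`-adic and archimedean Haar measures"), monotone under inclusion of admissible regions, and
the HOLOMORPHIC HULL as a closure operator on regions ([IUTchIII] Rem. 3.9.5; DH §4.12 p. 16: "The hull of
`Ω ⊂ L` is then defined to be the smallest polydisc containing `Ω`"; LANA §5.2 (d) p. 29: "the holomorphic
hull of `S`, denoted by `S^{hol}`, is the smallest `VC(O)`-submodule of `VC(K)` that contains `S`").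
Admissibility (finite log-volume) of the ONE hull the passage uses is not a property of the container but part
of the Corollary's statement ("Then it holds that `−|log(Θ)| ∈ ℝ`") — see `Cor312Setting.Uhol_adm`. INTERFACE
structure: the fields are the properties the passage uses, not the constructions (L-DH D3/D4/D6/D8).
[cite: DupuyHilado2025, §1 pp. 3–4] -/
structure VolumeContainer where
  /-- the carrier `𝕃` -/
  L : Type
  /-- the admissible regions `N(𝕃)` ("random measurable sets", DH Def. 3.6.3) -/
  Adm : Set L → Prop
  /-- `ln ν̄_𝕃` (procession-normalized mono-analytic log-volume), used on admissible regions only -/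
  logvol : Set L → ℝ
  /-- log-volume is monotone under inclusion of admissible regions -/
  logvol_mono : ∀ ⦃A B : Set L⦄, Adm A → Adm B → A ⊆ B → logvol A ≤ logvol B
  /-- the holomorphic hull: extensive, monotone, idempotent -/
  hull : ClosureOperator (Set L)

/-- **The nouns of Corollary 3.12** over a volume container: the POSSIBLE IMAGES `{U_λ}_λ` of the Θ-pilot
object ([IUTchIII] Cor. 3.12: "the union of the possible images of a Θ-pilot object …, which we regard as
subject to the indeterminacies (Ind1), (Ind2), (Ind3)"; LANA §8.1 (c) p. 40: "regions `{^{0,0}U_λ}_λ` of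
possible images of the Θ-pilot object are obtained", read in the right-hand container after §8.1 (d)–(e);
Dupuy–Hilado's `U_Θ` is their union) and the IMAGE `Q` of the `q`-pilot object ("which we do *not* regard
as subject to the indeterminacies"; LANA §8.1 (a) p. 40). LANA Rem. 8.3.1 p. 43: "It is asserted that, as a result of the ladder
argument, these two calculations meet inside the same right-hand volume container" — hence ONE container. HYPOTHESIS structure (objects, no
claims). [claim: Mochizuki2012, status: disputed] -/
structure Cor312Setting extends VolumeContainer where
  /-- indices `λ` of the possible images (the indeterminacies) -/
  Idx : Type
  /-- the possible images `U_λ` of the Θ-pilot object -/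
  U : Idx → Set L
  /-- possible images are admissible regions -/
  U_adm : ∀ i, Adm (U i)
  /-- "Write `−|log(Θ)| ∈ ℝ ∪ {+∞}` … Then it holds that `−|log(Θ)| ∈ ℝ`" ([IUTchIII] Cor. 3.12): the holomorphic
  hull of the union of the possible images is an admissible region (finite log-volume) — part of the
  Corollary's STATEMENT, recorded as data of the setting, never derived here -/
  Uhol_adm : Adm (hull (⋃ i, U i))
  /-- the image of the `q`-pilot object -/
  Q : Set L
  /-- it is an admissible region -/
  Q_adm : Adm Q

namespace Cor312Setting

variable (C : Cor312Setting)

/-- `U^{hol}` := the holomorphic hull of the union of the possible images (LANA §8.1 (f) p. 41: "Taking the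
union of the possible image regions `{^{1,1}U_λ}_λ`, one takes the holomorphic hull (with respect to the
ring structure at (1,1)) `^{1,1}U^{hol} ⊆ VC(^{1,1}I)`"; Dupuy–Hilado `hull(U_Θ)`).
[cite: LANA2026Report, §8.1 (f) p. 41] -/
def Uhol : Set C.L := C.hull (⋃ i, C.U i)

/-- `−|log(Θ)|` := the log-volume of `U^{hol}` (LANA §8.1 (h) p. 41: "The value `log-vol((U^{hol})^{det})`
is `−|log(Θ)|`"; DH p. 4: `ln ν̄_𝕃(hull(U_Θ))`). [cite: LANA2026Report, §8.1 (h) p. 41] -/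
def negLogTheta : ℝ := C.logvol C.Uhol

/-- `−|log(q)|` := the log-volume of the `q`-pilot image, "computed in the usual way in the right-hand
column" (§8.1 (a) p. 40). [cite: LANA2026Report, §8.1 (a) p. 40] -/
def negAbsLogq : ℝ := C.logvol C.Q

/-- **Corollary 3.12 in its own nouns**: `−|log(q)| ≤ −|log(Θ)|` (LANA (8-1) p. 41; Dupuy–Hilado (1.1)
p. 3 `−deĝ(P_q) ≤ −deĝ_lgp(P_{hull(U_Θ)})`; [IUTchIII] Cor. 3.12 "`−|log(Θ)| ≥ −|log(q)|` — i.e.,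
`C_Θ ≥ −1`"). HYPOTHESIS, never asserted here. [claim: Mochizuki2012, status: disputed] -/
@[claim "Mochizuki2012" "disputed"] def Cor312 : Prop := C.negAbsLogq ≤ C.negLogTheta

/-- Each possible image lies in `U^{hol}` (union, then hull is extensive). [folklore] -/
theorem U_subset_Uhol (i : C.Idx) : C.U i ⊆ C.Uhol :=
  (Set.subset_iUnion C.U i).trans (C.hull.le_closure _)

/-- `U^{hol}` is admissible ("`−|log(Θ)| ∈ ℝ`", by the datum `Uhol_adm`). [claim: Mochizuki2012, status: disputed] -/
theorem adm_Uhol : C.Adm C.Uhol := C.Uhol_adm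

/-- **PROVED: every possible image has log-volume `≤ −|log(Θ)|`** — monotonicity of `ln ν̄` and
extensivity of the hull. This is the field `vol_le_hull` that `ForkLana.OutputRegions` had to POSIT
("the hull contains every admissible region and log-volume is monotone"); at the level of regions it is a
theorem. [folklore] -/
theorem logvol_U_le_negLogTheta (i : C.Idx) : C.logvol (C.U i) ≤ C.negLogTheta :=
  C.logvol_mono (C.U_adm i) C.adm_Uhol (C.U_subset_Uhol i)

/-- The real-number shadow (`ForkLana.OutputRegions`) of a Cor-3.12 setting: admissible regions = the
possible images with their log-volumes, `−|log(Θ)|`, `−|log(q)|` — with `vol_le_hull` DISCHARGED.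
[cite: LANA2026Report, §8.1 pp. 40–41] -/
def toOutputRegions : OutputRegions where
  S := C.Idx
  vol i := C.logvol (C.U i)
  negLogTheta := C.negLogTheta
  vol_le_hull := C.logvol_U_le_negLogTheta
  negAbsLogq := C.negAbsLogq

/-- The shadow's `Cor312` is this file's `Cor312`. [folklore] -/
theorem toOutputRegions_cor312_iff : C.toOutputRegions.Cor312 ↔ C.Cor312 := Iff.rfl

/-! ### The three readings of Step (xi) at this level (hypotheses, none asserted) -/

/-- READING 1 (volume level) — LANA §8.3 p. 43: "accordiong [sic] to Mochizuki's interpretation …, the IPL,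
SHE, and APT properties implies that the set of procession-normalized log-volumes of the admissible output regions
contains the `q`-pilot log-volume as one of its possible values"; §9.3 p. 46:
"at the level of degree (log-volume), the rigidified `q`-pilot is represented in the output regions"
(`ForkLana.OutputRegions.Represented`; (9-1) of `ForkEta`). HYPOTHESIS. Tagging note (referee R8-N1 /
ref-b B1-10, recorded by skel gen 3): like Readings 2 and 3 below, this is a reading of the SAME disputed
passage ([IUTchIII] Cor. 3.12 proof, Step (xi-f) p. 184: "constitutes … a construction … of the pilot-object
log-volume of the input data … namely, `−|log(q)|`"); the `cite` attribute records whose PARAPHRASE it is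
(LANA's), the claim tag here records whose CLAIM it paraphrases — no reading is privileged by its tag.
[cite: LANA2026Report, §8.3 p. 43] [claim: Mochizuki2012, status: disputed] -/
@[cite "LANA2026Report" "§8.3 p. 43"] def RepresentedVol : Prop := ∃ i, C.logvol (C.U i) = C.negAbsLogq

/-- Reading 1 is `Represented` of the shadow. [folklore] -/
theorem representedVol_iff : C.RepresentedVol ↔ C.toOutputRegions.Represented := Iff.rfl

/-- The §9.2 `η`-setting (`ForkEta.EtaSetting`) carried by a Cor-3.12 setting, for any choice of the pointed
line `ℝ^val`: regions = the admissible regions with `ln ν̄` ("`ℝ^ss = {T ⊂ VC(I_v) | adelic and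
measurable}/∼`", §9.2 p. 46), suitable structures `S` = the indices of the possible images with `1·S := U_S`,
the `q`-pilot region `Q`, hull volume `−|log(Θ)|` — with the posited `vol_LGP_le_hull` DISCHARGED.
[cite: LANA2026Report, §9.2 p. 46] -/
def toEtaSetting (Rval : PointedLine) : EtaSetting where
  Rval := Rval
  Region := {A : Set C.L // C.Adm A}
  vol A := C.logvol A.1
  S := C.Idx
  LGP i := ⟨C.U i, C.U_adm i⟩
  qRegion := ⟨C.Q, C.Q_adm⟩
  hull := C.negLogTheta
  vol_LGP_le_hull := C.logvol_U_le_negLogTheta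

/-- **(9-1) for the carried `η`-setting ⟺ Reading 1** (`ForkEta.EtaSetting.mainGoal_iff_vol`): at the level
of regions-modulo-equal-volume, LANA's main goal says that some possible image has the log-volume of the
`q`-pilot image. [cite: LANA2026Report, §9.2 (9-1) p. 46] -/
theorem mainGoal_iff_representedVol (Rval : PointedLine) :
    (C.toEtaSetting Rval).MainGoal ↔ C.RepresentedVol := by
  rw [EtaSetting.mainGoal_iff_vol]
  rfl

/-- READING 2 (regions, containment) — "`−|log(q)| ∈ ℝ_{≤−|log(Θ)|}`" (LANA §8.3 p. 43, after [IUTchIII]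
Step (xi)) read one level down: the `q`-pilot image lies in the holomorphic hull of the possible images of
the Θ-pilot object. HYPOTHESIS. [claim: Mochizuki2012, status: disputed] -/
@[claim "Mochizuki2012" "disputed"] def QSubHull : Prop := C.Q ⊆ C.Uhol

/-- READING 3 (regions, identity) — the `q`-pilot image IS one of the possible images of the Θ-pilot object
(the strongest set-level form of "two tautologically equivalent ways to compute the `q`-pilot log-volume",
[IUTchIII] p. 421 as quoted in LANA §8.1 (a) p. 40, and of (IPL) "linked … to the input data prime-strip,
i.e., the "coric"/"fixed" `q`-pilot", Rem. 3.11.1 (iii) as quoted in LANA §8.2 p. 42). HYPOTHESIS.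
[claim: Mochizuki2012, status: disputed] -/
@[claim "Mochizuki2012" "disputed"] def QIsImage : Prop := ∃ i, C.U i = C.Q

/-- Reading 3 ⟹ Reading 1. [folklore] -/
theorem representedVol_of_qIsImage (h : C.QIsImage) : C.RepresentedVol := by
  obtain ⟨i, hi⟩ := h
  exact ⟨i, by rw [hi]; rfl⟩

/-- Reading 3 ⟹ Reading 2. [folklore] -/
theorem qSubHull_of_qIsImage (h : C.QIsImage) : C.QSubHull := by
  obtain ⟨i, hi⟩ := h
  rw [QSubHull, ← hi]
  exact C.U_subset_Uhol i

/-- **Reading 1 ⟹ Cor. 3.12** (LANA §8.3 p. 43: "That is, `−|log(q)| ∈ ℝ_{≤−|log(Θ)|}`. By the definition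
of `ℝ_{≤−|log(Θ)|}`, this means `−|log(q)| ≤ −|log(Θ)|`") — kernel-trivial given `logvol_U_le_negLogTheta`.
[cite: LANA2026Report, §8.3 p. 43] -/
theorem cor312_of_representedVol (h : C.RepresentedVol) : C.Cor312 := by
  obtain ⟨i, hi⟩ := h
  rw [Cor312, ← hi]
  exact C.logvol_U_le_negLogTheta i

/-- **Reading 2 ⟹ Cor. 3.12** — monotonicity of `ln ν̄`. [folklore] -/
theorem cor312_of_qSubHull (h : C.QSubHull) : C.Cor312 :=
  C.logvol_mono C.Q_adm C.adm_Uhol h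

end Cor312Setting

/-- A finite witness container: carrier `ℕ`, every region admissible, `ln ν̄(A) := 𝟙_A(0) + 𝟙_A(1)`
(monotone), hull = identity. [folklore] -/
def witnessContainer : VolumeContainer where
  L := ℕ
  Adm _ := True
  logvol A := A.indicator (fun _ => (1 : ℝ)) 0 + A.indicator (fun _ => (1 : ℝ)) 1
  logvol_mono _ _ _ _ hAB :=
    add_le_add (Set.indicator_le_indicator_of_subset hAB (fun _ => zero_le_one) 0)
      (Set.indicator_le_indicator_of_subset hAB (fun _ => zero_le_one) 1)
  hull := ClosureOperator.id (Set ℕ)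

/-- The witness setting over `witnessContainer`: one possible image `{0,1}`, `q`-pilot image `{0,5}`.
[folklore] -/
def witnessSetting : Cor312Setting where
  toVolumeContainer := witnessContainer
  Idx := Unit
  U _ := ({0, 1} : Set ℕ)
  U_adm _ := trivial
  Uhol_adm := trivial
  Q := ({0, 5} : Set ℕ)
  Q_adm := trivial

/-- **The readings differ from the inequality**: one possible image `{0,1}` (log-volume `2`), `q`-pilot
image `{0,5}` (log-volume `1`), hull = identity: Cor. 3.12 holds (`1 ≤ 2`) while Reading 1 fails (`2 ≠ 1`)
and Reading 2 fails (`5 ∉ {0,1}`). So `Cor312` is strictly weaker than each reading that yields it — the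
inequality does not say which reading one has granted (cf. `ForkLana.OutputRegions.cor312_not_imp_represented`).
[folklore] -/
theorem readings_differ :
    ∃ C : Cor312Setting, C.Cor312 ∧ ¬ C.RepresentedVol ∧ ¬ C.QSubHull := by
  have hU : (⋃ _ : Unit, ({0, 1} : Set ℕ)) = {0, 1} := Set.iUnion_const _
  have h01 : witnessContainer.logvol ({0, 1} : Set ℕ) = 2 := by
    simp only [witnessContainer, Set.indicator_apply, Set.mem_insert_iff, Set.mem_singleton_iff]
    norm_num
  have h05 : witnessContainer.logvol ({0, 5} : Set ℕ) = 1 := by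
    simp only [witnessContainer, Set.indicator_apply, Set.mem_insert_iff, Set.mem_singleton_iff]
    norm_num
  have hhol : witnessSetting.Uhol = ({0, 1} : Set ℕ) := by
    show ClosureOperator.id (Set ℕ) (⋃ _ : Unit, ({0, 1} : Set ℕ)) = {0, 1}
    rw [hU]
    rfl
  refine ⟨witnessSetting, ?_, ?_, ?_⟩
  · show witnessContainer.logvol ({0, 5} : Set ℕ) ≤ witnessContainer.logvol witnessSetting.Uhol
    rw [hhol, h01, h05]
    norm_num
  · rintro ⟨_, h⟩
    change witnessContainer.logvol ({0, 1} : Set ℕ) = witnessContainer.logvol ({0, 5} : Set ℕ) at h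
    rw [h01, h05] at h
    norm_num at h
  · intro h
    have h5' : (5 : ℕ) ∈ witnessSetting.Uhol := h (show (5 : ℕ) ∈ ({0, 5} : Set ℕ) by simp)
    rw [hhol] at h5'
    have h5 : (5 : ℕ) ∈ ({0, 1} : Set ℕ) := h5'
    simp at h5

/-! ## §7. READING 4 — containment up to isomorphism (Yamashita's rendering; gen 3 addition) -/

namespace Cor312Setting

variable (C : Cor312Setting)

/-- READING 4 (containment UP TO ISOMORPHISM) — Yamashita's one-paragraph proof of his Cor. 13.13 (= [IUTchIII]
Cor. 3.12), *A proof of the abc conjecture after Mochizuki* (version 25 June 2024), PDF p. 390 l. 30–38 of this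
seat's render (the (Indet) symbols as corrected by ref lane R, PASS-R14 F2, against the page's glyphs: rotation
`↶↷` = the automorphism indeterminacy, `→` = the horizontal one, `↑` = the vertical/log-Kummer one): "Then Corollary
follows by comparing the log-volumes (Note that log-volumes are invariant under (Indet ↶↷), (Indet →), and also
compatible with log-Kummer correspondence …) of (1,0)-labelled q-pilot objects … and (1,∘)-labelled Θ-pilot objects,
since, in the mono-analytic containers (i.e., ℚ-spans of log-shells), the holomorphic hull of the union of possible
images of Θ-pilot objects subject to indeterminacies (Indet ↶↷), (Indet →), (Indet ↑) contains a region which is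
isomorphic (not equal) to the region determined by the q-pilot objects (This means that "very small region with
indeterminacies" contains "almost unit region")." NB the page claims INVARIANCE of the log-volume only under
(Indet ↶↷) and (Indet →); under the log-Kummer indeterminacy (Indet ↑) it claims COMPATIBILITY (upper
semi-compatibility — cf. [IUTchIII] Thm. 3.11 (ii) (Ind3)), not invariance. Typed at
this level with the isomorphism abstracted to what the sentence uses of it (log-volume invariance): SOME
admissible region inside the hull has the log-volume of `Q`. HYPOTHESIS, none asserted. It is WEAKER than
Readings 1–3 (`qIsoInHull_of_representedVol`, `qIsoInHull_of_qSubHull`) and still yields `Cor312`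
(`cor312_of_qIsoInHull`); and, the region not being `Q` itself, it is a per-labelling (passive) statement in
the sense of skel XXIId `ForkInd1Passive` — certifiable without knowing the relative labelling of the
`(1,0)`-packet. [cite: Yamashita2024IUTSurvey, Cor. 13.13 proof, PDF p. 390 l. 30–38] [claim: Mochizuki2012, status: disputed] -/
@[claim "Mochizuki2012" "disputed"] def QIsoInHull : Prop := ∃ R : Set C.L, C.Adm R ∧ R ⊆ C.Uhol ∧ C.logvol R = C.negAbsLogq

/-- Reading 1 ⟹ Reading 4 (take the represented possible image). [folklore] -/
theorem qIsoInHull_of_representedVol (h : C.RepresentedVol) : C.QIsoInHull := by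
  obtain ⟨i, hi⟩ := h
  exact ⟨C.U i, C.U_adm i, C.U_subset_Uhol i, hi⟩

/-- Reading 2 ⟹ Reading 4 (take `Q` itself). [folklore] -/
theorem qIsoInHull_of_qSubHull (h : C.QSubHull) : C.QIsoInHull := ⟨C.Q, C.Q_adm, h, rfl⟩

/-- Reading 3 ⟹ Reading 4. [folklore] -/
theorem qIsoInHull_of_qIsImage (h : C.QIsImage) : C.QIsoInHull :=
  C.qIsoInHull_of_qSubHull (C.qSubHull_of_qIsImage h)

/-- **Reading 4 ⟹ Cor. 3.12** at this level (monotonicity of the log-volume on admissible regions: the region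
inside the hull has log-volume at most that of the hull). [claim: Mochizuki2012, status: disputed] -/
theorem cor312_of_qIsoInHull (h : C.QIsoInHull) : C.Cor312 := by
  obtain ⟨R, hR, hsub, hvol⟩ := h
  unfold Cor312 negLogTheta
  rw [← hvol]
  exact C.logvol_mono hR C.adm_Uhol hsub

/-- Reading 4 is STRICTLY weaker than Readings 1 and 2: in the witness setting above (one possible image
`{0,1}` of log-volume `2`, `Q = {0,5}` of log-volume `1`, hull = identity) the region `{0} ⊆ {0,1}` has
log-volume `1 = ln ν̄(Q)`, so Reading 4 HOLDS while Reading 1 (`2 ≠ 1`) and Reading 2 (`5 ∉ {0,1}`) fail.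
[folklore] -/
theorem reading4_strictly_weaker :
    ∃ C : Cor312Setting, C.QIsoInHull ∧ ¬ C.RepresentedVol ∧ ¬ C.QSubHull := by
  have h05 : witnessContainer.logvol ({0, 5} : Set ℕ) = 1 := by
    simp only [witnessContainer, Set.indicator_apply, Set.mem_insert_iff, Set.mem_singleton_iff]
    norm_num
  have h0 : witnessContainer.logvol ({0} : Set ℕ) = 1 := by
    simp only [witnessContainer, Set.indicator_apply, Set.mem_singleton_iff]
    norm_num
  have h01 : witnessContainer.logvol ({0, 1} : Set ℕ) = 2 := by
    simp only [witnessContainer, Set.indicator_apply, Set.mem_insert_iff, Set.mem_singleton_iff]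
    norm_num
  have hU : (⋃ _ : Unit, ({0, 1} : Set ℕ)) = {0, 1} := Set.iUnion_const _
  have hhol : witnessSetting.Uhol = ({0, 1} : Set ℕ) := by
    show ClosureOperator.id (Set ℕ) (⋃ _ : Unit, ({0, 1} : Set ℕ)) = {0, 1}
    rw [hU]
    rfl
  refine ⟨witnessSetting, ?_, ?_, ?_⟩
  · show ∃ R : Set ℕ, True ∧ R ⊆ witnessSetting.Uhol ∧
      witnessContainer.logvol R = witnessContainer.logvol ({0, 5} : Set ℕ)
    refine ⟨{0}, trivial, ?_, ?_⟩
    · rw [hhol]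
      intro x hx
      have hx0 : x = 0 := hx
      simp [hx0]
    · rw [h0, h05]
  · rintro ⟨_, h⟩
    change witnessContainer.logvol ({0, 1} : Set ℕ) = witnessContainer.logvol ({0, 5} : Set ℕ) at h
    rw [h01, h05] at h
    norm_num at h
  · intro h
    have h5' : (5 : ℕ) ∈ witnessSetting.Uhol := h (show (5 : ℕ) ∈ ({0, 5} : Set ℕ) by simp)
    rw [hhol] at h5'
    have h5 : (5 : ℕ) ∈ ({0, 1} : Set ℕ) := h5'
    simp at h5

end Cor312Setting

end IUTFork

end Summit.ABC

end
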